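import Summits.QuantumFields.YangMills.Theorems.UnitScaleTiltHalvingStubOfPillarsStatCE
import Summits.QuantumFields.YangMills.Theorems.UnitScaleTiltHalvingSmallMembersCoverLiftTangent
import HarnessLib

/-!
# Route `UnitScaleTilt`, crux K1 child «MinimiserStabilityRegPr» (stmt-QuantumFields-19200), registered stub V2′ `stub_halvingStep` (skeleton v10 `BirthV10`) —
# **THE ONE-HYPOTHESIS H DOOR (★★OWNER RULING g27-№4: «H = hP1room BY KERNEL»)**: `stub_halvingStep_of_hP1room (hP1room) : <BirthV10.stub_halvingStep VERBATIM>` :=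
# ✓`HalvingStubOfPillarsStatCE.stub_halvingStep_of_pillarsStat₂` ✓`SmallMembersCoverLiftTangent.statLift` `hP1room` — the H-SMALL cover lift `hlift` is the theorem
# ✓p635687 `statLift` (★w3-20520 g5), the C_E text is ✓p637226∕✓p637671 (★w8-19200 g2), the P2 text is ✓p625735 (★w1-20520 g6), the door v3 chain and the capstone are
# ★w3-19200 g5's; the registered H-stub text now follows from EXACTLY ONE displayed text, `hP1room` (P1♭ v1.1 at the members with room, behind the supplier floors
# `(Mₚ, Rₚ)` — LEAD-H BOARD «H = hP1room» ∕ the J-N05♭ `core′` per-site checklist of LEAD-H 12:20:41Z (1))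

Cell `ym3-torus` (HUMAN RULING D-0037, YM ladder rung R3 — continuum SU(2) YM₃ on the torus is a RUNG, not the Clay problem), width seat `ym-ust-19200-w8` gen 2
(D-0154 (3c)).  `--supports stmt-QuantumFields-19200 --as helper`; count-neutral; def-free, 0 sorry, standard axioms.  `hP1room` is a HYPOTHESIS: nothing here claims the stub,
the crux, the rung or the mass gap; no summit statement is proved by this seat.  Bookkeeping (one application); the mathematics is in the cited files.

References: T. Bałaban, CMP **102** (1985) 277–309 [Balaban1985Variational] Thm 1 p.279, (2)–(8) pp.278–279, (144) p.300, (150)–(168) pp.301–304, Prop. 8 p.304;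
CMP **99** (1985) 75–102 [Balaban1985RegularSpaces] Thm 2 p.83. -/

set_option autoImplicit false

noncomputable section

open scoped BigOperators Matrix.Norms.L2Operator

namespace Summit.QuantumFields.YangMills.Theorems.HalvingStubOfHP1Room

open Literature.MathematicalPhysics.QuantumFieldTheory.Balaban1983to89
open Literature.MathematicalPhysics.QuantumFieldTheory.Balaban1983to89.T3ContinuumYM3Torus
open Literature.MathematicalPhysics.QuantumFieldTheory.Balaban1983to89.T3PrintedRegularMinimiser
open Literature.MathematicalPhysics.QuantumFieldTheory.Balaban1983to89.T3Thm1Carrier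
open FlatCubeSequenceAligned (cubeSeqMT3 cubeSetM)
open HalvingP1FlatPillarPrime (P1FlatPillarAt')
open HalvingStubOfPillarsStatCE (stub_halvingStep_of_pillarsStat₂)
open SmallMembersCoverLiftTangent (statLift)

/-- ★★★ **THE ONE-HYPOTHESIS H DOOR**: the registered text of `BirthV10.stub_halvingStep` from the roomed P1♭ pillar `hP1room` alone (H-SMALL lift, C_E and P2 texts
discharged by name). [cite: Balaban1985Variational, Thm 1 p.279, (150)-(168) pp.301-304, Prop. 8 p.304; Balaban1985RegularSpaces, Thm 2 p.83] -/
theorem stub_halvingStep_of_hP1room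
    (hP1room : ∀ L : ℕ, Odd L → 1 < L → ∃ (Mₚ Rₚ : ℕ), ∀ (R M aₑ S : ℕ) (hM : 1 ≤ M), M = L ^ aₑ → Mₚ ≤ M → Rₚ ≤ R → R * M ≤ S →
      ∃ B₁ : ℝ, 0 ≤ B₁ ∧ ∃ Nr : ℕ,
      ∀ (ρ : ℕ) (a Cr : ℝ), 0 < Cr → 12 * ((ρ : ℝ) + (M : ℝ)) * a ≤ Cr →
        16 * 3800 * ((5 * L : ℕ) : ℝ) ^ 2 * (L : ℝ) * ((B₁ + 1) * a) ≤ 1 →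
        ∀ F : T3Family, F.L = L → ∀ (n K : ℕ) (hnK : n < K), 2 * ρ + Nr ≤ F.L ^ (F.m + n) →
          ∀ (ε₀ ε₁ : ℝ), 0 < ε₁ → 0 < ε₀ → ε₀ ≤ a → Cr * ε₁ ≤ ε₀ →
          ∀ V : GaugeField (F.P n) 0 (Matrix.specialUnitaryGroup (Fin 2) ℂ), PlaqSmall ε₁ V →
            ∀ U ∈ regFibrePr F n K hnK.le ε₀ V, ∀ x : Site (F.P K) 0,
              P1FlatPillarAt' F n K (cubeSeqMT3 F n K x ρ S M hM) (cubeSetM x (K - n) ρ S M 0) x ε₀ ε₁ B₁ 6 (8 * (L : ℝ) * (B₁ + 1)) U) :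
    ∀ (L : ℕ), 1 < L → ∃ B₃ : ℝ, 4 < B₃ ∧ ∃ a₅ : ℝ, 0 < a₅ ∧
      ∀ (i : Idx L) (ε₀ ε₁ : ℝ), 0 < ε₁ → ∀ (V : (famX L i).Bdry) (U : (famX L i).Cfg), (famX L i).Reg7 ε₁ V → (famX L i).InU ε₀ U →
        (famX L i).InB V U → (famX L i).IsCritical V U → ε₀ ≤ a₅ → (famX L i).InU (max (B₃ * ε₁) (ε₀ / 2)) U :=
  stub_halvingStep_of_pillarsStat₂ statLift hP1room

end Summit.QuantumFields.YangMills.Theorems.HalvingStubOfHP1Room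

end
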